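import Summits.CriticalPhenomena.PercolationContinuityZ3.Theorems.FK.InfiniteVolumeDLRKernelFKG
import Summits.CriticalPhenomena.PercolationContinuityZ3.Theorems.FK.InfiniteVolumeDLRTailLimit
import Summits.CriticalPhenomena.PercolationContinuityZ3.Theorems.FK.InfiniteVolumeDLRTailConditioning
import HarnessLib

/-!
# FK-continuity transplant, FO-06/FO-10 (infinite-volume structure): Grimmett 2006, Thm. (4.34)(a) and
# Prop. (4.37)(c) — `R_{p,q}` is convex, and every TAIL-TRIVIAL DLR random-cluster measure is positively associated

Registered R87 (cell INBOX l.6278, 2026-08-24); registry row FO-10b-g408; label DPA-C (coordinator fk-4 g192).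
Cell `fk-continuity` (bschramm), FO-10b lineage; support file for the FK-continuity transplant
(`--supports stmt-CriticalPhenomena-4575`); builds on p205010 (kernel theorem, internal audit signed; external expert
review pending). No named facts, no definitions, no sorries, standard axioms. Banked infinite-volume structure; not an
END-STATE dependency of the cell (not consumed by `_r3`); it says nothing about FH / TP_FK or continuity at `p_c`.

For the DLR class `R_{p,q}` (`IsDLRRandomCluster d p q P`, Grimmett's Def. (4.29), `InfiniteVolumeDLRDefs.lean`):

* `isDLRRandomCluster_add_smul` — **Thm. (4.34)(a), convexity**: `a • P₁ + b • P₂ ∈ R_{p,q}` for `P₁, P₂ ∈ R_{p,q}`,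
  `a + b = 1` ("convexity follows immediately from Definition 4.29");
* `rcCondLaw_apply_eq_sum_indicator`, `measurable_rcCondLaw_apply_outsideEvents`, `rcCondLaw_apply_le_one`,
  `toReal_rcCondLaw_apply_eq_sum_ite` — the kernel `ξ ↦ φ^ξ_{Λ,p,q}(A)` of an arbitrary measurable `A` is a
  `𝒯_Λ`-measurable sub-probability, equal to `∑_{η ∈ A} φ^ξ_{Λ,p,q}(η)` when `A` is determined by `E_Λ`;
* `IsDLRRandomCluster.toReal_rcCondLaw_ae_eq_condExp_indicator`, `IsDLRRandomCluster.sum_ite_rcCondProb_ae_eq_condExp_indicator`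
  — **(4.30) as a conditional expectation for EVERY measurable `A`**: `φ^·_{Λ,p,q}(A)` is a version of `P[1_A | 𝒯_Λ]`
  (from the DLR equation against outside events, `IsDLRRandomCluster.setLIntegral_rcCondLaw_eq`,
  `InfiniteVolumeDLRTailConditioning.lean`);
* **`IsDLRRandomCluster.real_mul_le_real_inter_of_isTailTrivial`** — **Prop. (4.37)(c)**: for `0 ≤ p ≤ 1`, `q ≥ 1`,
  `P ∈ R_{p,q}` carried by lattice configurations and TAIL-TRIVIAL, and increasing events `A`, `B` determined by the
  edges of a finite region: `P(A) P(B) ≤ P(A ∩ B)`.  Grimmett's proof verbatim: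
  `P(A ∩ B) = P(φ^·_Λ(A ∩ B)) ≥ P(φ^·_Λ(A) φ^·_Λ(B)) = P(P(A|𝒯_Λ) P(B|𝒯_Λ))` (DLR, then positive association of
  the kernel `InfiniteVolumeDLRKernelFKG.lean`), and `P(P(A|𝒯_Λ) P(B|𝒯_Λ)) = P(1_A P(B|𝒯_Λ)) → P(A) P(B)` as
  `Λ ↑ ℤ^d` along a subsequence, by Lévy's downward theorem and tail-triviality (`InfiniteVolumeDLRTailLimit.lean`).

It applies to `φ⁰_{p,q}`, `φ¹_{p,q}` (`isTailTrivial_rcLimit`) and to every extremal member of `R_{p,q}`.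

## References
* G. Grimmett, *The Random-Cluster Model*, Springer 2006: Def. (4.29) eq. (4.30), Thm. (4.34)(a), Prop. (4.37)(c)
  and its proof, pp. 81–83, 86–87. [Grimmett2006]
-/

noncomputable section

open MeasureTheory Filter Set Finset

open scoped Topology ENNReal

namespace Summit.CriticalPhenomena.PercolationContinuityZ3.Theorems.FK

open Literature.Probability.Percolation Literature.Probability.LatticeModels

variable {d : ℕ} {p q : ℝ}

/-! ### Thm. (4.34)(a): `R_{p,q}` is convex -/

section Convex

/-- **Grimmett 2006, Thm. (4.34)(a) (convexity of `R_{p,q}`)**: a convex combination of two DLR random-cluster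
measures is a DLR random-cluster measure — the integrated DLR equation `∫ φ^ξ_Λ(A) P(dξ) = P(A)` is linear in `P`.
[cite: Grimmett2006, Thm. (4.34)(a)] -/
theorem isDLRRandomCluster_add_smul {P₁ P₂ : Measure (BondConfig (Site d))} (h₁ : IsDLRRandomCluster d p q P₁)
    (h₂ : IsDLRRandomCluster d p q P₂) {a b : ℝ≥0∞} (hab : a + b = 1) :
    IsDLRRandomCluster d p q (a • P₁ + b • P₂) where
  isProbabilityMeasure := by
    haveI := h₁.isProbabilityMeasure
    haveI := h₂.isProbabilityMeasure
    refine ⟨?_⟩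
    simp only [Measure.coe_add, Measure.coe_smul, Pi.add_apply, Pi.smul_apply, smul_eq_mul, measure_univ,
      mul_one, hab]
  lintegral_rcCondLaw_eq := fun Λ A hA => by
    rw [lintegral_add_measure, lintegral_smul_measure, lintegral_smul_measure, h₁.lintegral_rcCondLaw_eq Λ hA,
      h₂.lintegral_rcCondLaw_eq Λ hA]
    simp only [Measure.coe_add, Measure.coe_smul, Pi.add_apply, Pi.smul_apply, smul_eq_mul]

end Convex

/-! ### The kernel probability of an `E_Λ`-event is a version of `P[1_A | 𝒯_Λ]` -/

section Kernel

variable {P : Measure (BondConfig (Site d))}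

/-- `φ^ξ_{Λ,p,q}(A) = ∑_{η ⊆ E_Λ} 1[η ∪ (ξ ∖ E_Λ) ∈ A] φ^ξ_{Λ,p,q}(η)` for every measurable `A`
(Grimmett 2006, (4.11)–(4.12): the kernel is a finite sum of Dirac masses). [cite: Grimmett2006, §4.2 (4.11)–(4.12)] -/
theorem rcCondLaw_apply_eq_sum_indicator (p q : ℝ) (Λ : Finset (Site d)) (ξ : BondConfig (Site d))
    {A : Set (BondConfig (Site d))} (hA : MeasurableSet A) :
    rcCondLaw p q Λ ξ A = ∑ η ∈ (edgesIn (zdGraph d) Λ).powerset,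
      ((fun ξ : BondConfig (Site d) => (↑η : Set (Sym2 (Site d))) ∪ (ξ \ ↑(edgesIn (zdGraph d) Λ))) ⁻¹' A).indicator
        (fun ξ => ENNReal.ofReal (rcCondProb p q Λ ξ η)) ξ := by
  rw [rcCondLaw_eq, Measure.finsetSum_apply]
  refine Finset.sum_congr rfl fun η _ => ?_
  rw [Measure.smul_apply, Measure.dirac_apply' _ hA, smul_eq_mul]
  by_cases h : ξ ∈ (fun ξ : BondConfig (Site d) => (↑η : Set (Sym2 (Site d))) ∪ (ξ \ ↑(edgesIn (zdGraph d) Λ))) ⁻¹' A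
  · rw [Set.indicator_of_mem (Set.mem_preimage.1 h), Set.indicator_of_mem h, Pi.one_apply, mul_one]
  · rw [Set.indicator_of_notMem (fun h' => h (Set.mem_preimage.2 h')), Set.indicator_of_notMem h, mul_zero]

/-- `ξ ↦ φ^ξ_{Λ,p,q}(A)` is `𝒯_Λ`-measurable for every measurable `A`. [cite: Grimmett2006, §4.4 (4.30)] -/
theorem measurable_rcCondLaw_apply_outsideEvents (p q : ℝ) (Λ : Finset (Site d)) {A : Set (BondConfig (Site d))}
    (hA : MeasurableSet A) : Measurable[outsideEvents d Λ] fun ξ : BondConfig (Site d) => rcCondLaw p q Λ ξ A := by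
  have h : (fun ξ : BondConfig (Site d) => rcCondLaw p q Λ ξ A) = fun ξ => ∑ η ∈ (edgesIn (zdGraph d) Λ).powerset,
      ((fun ξ : BondConfig (Site d) => (↑η : Set (Sym2 (Site d))) ∪ (ξ \ ↑(edgesIn (zdGraph d) Λ))) ⁻¹' A).indicator
        (fun ξ => ENNReal.ofReal (rcCondProb p q Λ ξ η)) ξ := funext fun ξ => rcCondLaw_apply_eq_sum_indicator p q Λ ξ hA
  rw [h]
  refine Finset.measurable_sum _ fun η _ => ?_
  exact ((measurable_rcCondProb_outsideEvents p q Λ η).ennreal_ofReal).indicator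
    (measurableSet_outsideEvents_preimage_union_sdiff Λ η hA)

/-- `φ^ξ_{Λ,p,q}(A) ≤ 1` (`0 ≤ p ≤ 1`, `q > 0`). [cite: Grimmett2006, §4.2 (4.12)] -/
theorem rcCondLaw_apply_le_one (hp : p ∈ Set.Icc (0 : ℝ) 1) (hq : 0 < q) (Λ : Finset (Site d))
    (ξ : BondConfig (Site d)) {A : Set (BondConfig (Site d))} (hA : MeasurableSet A) : rcCondLaw p q Λ ξ A ≤ 1 := by
  rw [rcCondLaw_apply_eq_sum_indicator p q Λ ξ hA]
  calc ∑ η ∈ (edgesIn (zdGraph d) Λ).powerset,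
        ((fun ξ : BondConfig (Site d) => (↑η : Set (Sym2 (Site d))) ∪ (ξ \ ↑(edgesIn (zdGraph d) Λ))) ⁻¹' A).indicator
          (fun ξ => ENNReal.ofReal (rcCondProb p q Λ ξ η)) ξ
      ≤ ∑ η ∈ (edgesIn (zdGraph d) Λ).powerset, ENNReal.ofReal (rcCondProb p q Λ ξ η) :=
        Finset.sum_le_sum fun η _ => Set.indicator_le_self _ _ ξ
    _ = ENNReal.ofReal (∑ η ∈ (edgesIn (zdGraph d) Λ).powerset, rcCondProb p q Λ ξ η) :=
        (ENNReal.ofReal_sum_of_nonneg fun η _ => rcCondProb_nonneg hp hq Λ ξ η).symm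
    _ = 1 := by rw [sum_rcCondProb_eq_one hp hq Λ ξ, ENNReal.ofReal_one]

/-- For an event `A` DETERMINED by `E_Λ`: `φ^ξ_{Λ,p,q}(A) = ∑_{η ⊆ E_Λ, η ∈ A} φ^ξ_{Λ,p,q}(η)` (the glued configuration
`η ∪ (ξ ∖ E_Λ)` agrees with `η` on `E_Λ`). [cite: Grimmett2006, §4.2 (4.11)–(4.12)] -/
theorem toReal_rcCondLaw_apply_eq_sum_ite (hp : p ∈ Set.Icc (0 : ℝ) 1) (hq : 0 < q) (Λ : Finset (Site d))
    (ξ : BondConfig (Site d)) {A : Set (BondConfig (Site d))} (hAm : MeasurableSet A)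
    (hA : DeterminedBy A ↑(edgesIn (zdGraph d) Λ)) [DecidablePred (· ∈ A)] :
    (rcCondLaw p q Λ ξ A).toReal = ∑ η ∈ (edgesIn (zdGraph d) Λ).powerset,
      (if (↑η : BondConfig (Site d)) ∈ A then rcCondProb p q Λ ξ η else 0) := by
  rw [rcCondLaw_apply_eq_sum_indicator p q Λ ξ hAm, ENNReal.toReal_sum fun η _ =>
    (Set.indicator_le_self _ _ ξ).trans_lt ENNReal.ofReal_lt_top |>.ne]
  refine Finset.sum_congr rfl fun η hη => ?_
  have hη' := Finset.mem_powerset.1 hη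
  have hiff : ((↑η : Set (Sym2 (Site d))) ∪ (ξ \ ↑(edgesIn (zdGraph d) Λ))) ∈ A ↔ (↑η : BondConfig (Site d)) ∈ A := by
    refine (determinedBy_iff _ _).1 hA _ _ ?_
    ext e
    simp only [Set.mem_inter_iff, Set.mem_union, Set.mem_sdiff, Finset.mem_coe]
    constructor
    · rintro ⟨he | ⟨-, hne⟩, heU⟩
      · exact ⟨he, heU⟩
      · exact absurd heU hne
    · rintro ⟨he, heU⟩
      exact ⟨Or.inl he, heU⟩
  by_cases h : (↑η : BondConfig (Site d)) ∈ A
  · have hmem : ξ ∈ (fun ξ : BondConfig (Site d) =>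
        (↑η : Set (Sym2 (Site d))) ∪ (ξ \ ↑(edgesIn (zdGraph d) Λ))) ⁻¹' A := Set.mem_preimage.2 (hiff.2 h)
    rw [if_pos h, Set.indicator_of_mem hmem, ENNReal.toReal_ofReal (rcCondProb_nonneg hp hq Λ ξ η)]
  · have hnot : ξ ∉ (fun ξ : BondConfig (Site d) =>
        (↑η : Set (Sym2 (Site d))) ∪ (ξ \ ↑(edgesIn (zdGraph d) Λ))) ⁻¹' A :=
      fun h' => h (hiff.1 (Set.mem_preimage.1 h'))
    rw [if_neg h, Set.indicator_of_notMem hnot, ENNReal.toReal_zero]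

/-- Measurability of the kernel probability `ξ ↦ φ^ξ_{Λ,p,q}(A) = ∑_{η ⊆ E_Λ, η ∈ A} φ^ξ_{Λ,p,q}(η)` with respect to
the outside σ-algebra `𝒯_Λ`. [cite: Grimmett2006, §4.4 (4.30)] -/
theorem measurable_sum_ite_rcCondProb_outsideEvents (p q : ℝ) (Λ : Finset (Site d)) (A : Set (BondConfig (Site d)))
    [DecidablePred (· ∈ A)] :
    Measurable[outsideEvents d Λ] fun ξ : BondConfig (Site d) =>
      ∑ η ∈ (edgesIn (zdGraph d) Λ).powerset,
        (if (↑η : BondConfig (Site d)) ∈ A then rcCondProb p q Λ ξ η else 0) := by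
  refine Finset.measurable_sum _ fun η _ => ?_
  by_cases h : (↑η : BondConfig (Site d)) ∈ A
  · simp only [h, if_true]
    exact measurable_rcCondProb_outsideEvents p q Λ η
  · simp only [h, if_false]
    exact measurable_const

/-- The kernel probability of an event lies in `[0, 1]`. [cite: Grimmett2006, §4.2 (4.12)] -/
theorem sum_ite_rcCondProb_mem_Icc (hp : p ∈ Set.Icc (0 : ℝ) 1) (hq : 0 < q) (Λ : Finset (Site d))
    (ξ : BondConfig (Site d)) (A : Set (BondConfig (Site d))) [DecidablePred (· ∈ A)] :
    (∑ η ∈ (edgesIn (zdGraph d) Λ).powerset,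
        (if (↑η : BondConfig (Site d)) ∈ A then rcCondProb p q Λ ξ η else 0)) ∈ Set.Icc (0 : ℝ) 1 := by
  constructor
  · exact Finset.sum_nonneg fun η _ => by
      split_ifs
      · exact rcCondProb_nonneg hp hq Λ ξ η
      · exact le_rfl
  · rw [← sum_rcCondProb_eq_one hp hq Λ ξ]
    exact Finset.sum_le_sum fun η _ => by
      split_ifs
      · exact le_rfl
      · exact rcCondProb_nonneg hp hq Λ ξ η

/-- Integrability of the kernel probability of an event (it is measurable with values in `[0,1]`).
[cite: Grimmett2006, §4.4 (4.30)] -/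
theorem integrable_sum_ite_rcCondProb (P : Measure (BondConfig (Site d))) [IsFiniteMeasure P]
    (hp : p ∈ Set.Icc (0 : ℝ) 1) (hq : 0 < q) (Λ : Finset (Site d)) (A : Set (BondConfig (Site d)))
    [DecidablePred (· ∈ A)] :
    Integrable (fun ξ : BondConfig (Site d) => ∑ η ∈ (edgesIn (zdGraph d) Λ).powerset,
      (if (↑η : BondConfig (Site d)) ∈ A then rcCondProb p q Λ ξ η else 0)) P := by
  refine Integrable.mono' (integrable_const (1 : ℝ))
    ((measurable_sum_ite_rcCondProb_outsideEvents p q Λ A).mono (outsideEvents_le Λ) le_rfl).aestronglyMeasurable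
    (ae_of_all _ fun ξ => ?_)
  have h := sum_ite_rcCondProb_mem_Icc hp hq Λ ξ A
  rw [Real.norm_eq_abs, abs_of_nonneg h.1]
  exact h.2

/-- **(4.30) as a conditional expectation, for every measurable event**: for `P ∈ R_{p,q}` (`0 ≤ p ≤ 1`, `q > 0`),
a finite region `Λ` and a measurable `A`, `ξ ↦ φ^ξ_{Λ,p,q}(A)` is a version of `P[1_A | 𝒯_Λ]` — its integrals over
outside events are `P(A ∩ B)` (`IsDLRRandomCluster.setLIntegral_rcCondLaw_eq`). [cite: Grimmett2006, Def. (4.29) eq. (4.30)] -/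
theorem IsDLRRandomCluster.toReal_rcCondLaw_ae_eq_condExp_indicator (hP : IsDLRRandomCluster d p q P)
    (hp : p ∈ Set.Icc (0 : ℝ) 1) (hq : 0 < q) (Λ : Finset (Site d)) {A : Set (BondConfig (Site d))}
    (hA : MeasurableSet A) :
    (fun ξ : BondConfig (Site d) => (rcCondLaw p q Λ ξ A).toReal) =ᵐ[P]
      P[A.indicator (fun _ => (1 : ℝ)) | outsideEvents d Λ] := by
  haveI := hP.isProbabilityMeasure
  have hmeasE : Measurable fun ξ : BondConfig (Site d) => rcCondLaw p q Λ ξ A :=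
    (measurable_rcCondLaw_apply_outsideEvents p q Λ hA).mono (outsideEvents_le Λ) le_rfl
  have hmeas : Measurable[outsideEvents d Λ] fun ξ : BondConfig (Site d) => (rcCondLaw p q Λ ξ A).toReal :=
    (measurable_rcCondLaw_apply_outsideEvents p q Λ hA).ennreal_toReal
  have hmeas' : Measurable fun ξ : BondConfig (Site d) => (rcCondLaw p q Λ ξ A).toReal := hmeasE.ennreal_toReal
  have hbdd : ∀ ξ, ‖(rcCondLaw p q Λ ξ A).toReal‖ ≤ 1 := fun ξ => by
    rw [Real.norm_eq_abs, abs_of_nonneg ENNReal.toReal_nonneg]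
    exact ENNReal.toReal_le_of_le_ofReal zero_le_one
      (by rw [ENNReal.ofReal_one]; exact rcCondLaw_apply_le_one hp hq Λ ξ hA)
  have hint : Integrable (fun ξ : BondConfig (Site d) => (rcCondLaw p q Λ ξ A).toReal) P :=
    Integrable.mono' (integrable_const (1 : ℝ)) hmeas'.aestronglyMeasurable (ae_of_all _ hbdd)
  refine ae_eq_condExp_of_forall_setIntegral_eq (outsideEvents_le Λ) ((integrable_const (1 : ℝ)).indicator hA)
    (fun s _ _ => hint.integrableOn) (fun s hs _ => ?_) hmeas.stronglyMeasurable.aestronglyMeasurable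
  rw [integral_indicator hA, setIntegral_const, smul_eq_mul, mul_one, measureReal_restrict_apply hA,
    integral_toReal hmeasE.aemeasurable.restrict
      (ae_of_all _ fun ξ => (rcCondLaw_apply_le_one hp hq Λ ξ hA).trans_lt ENNReal.one_lt_top),
    hP.setLIntegral_rcCondLaw_eq hp hq Λ hA hs, measureReal_def]

/-- **The kernel probability of an `E_Λ`-event is the conditional probability** (Grimmett 2006, (4.30), summed over
the patterns of `A`): for `P ∈ R_{p,q}` (`0 ≤ p ≤ 1`, `q > 0`), a finite region `Λ` and a measurable event `A`
determined by `E_Λ`, `ξ ↦ ∑_{η ∈ A} φ^ξ_{Λ,p,q}(η)` is a version of `P[1_A | 𝒯_Λ]`. [cite: Grimmett2006, Def. (4.29) eq. (4.30)] -/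
theorem IsDLRRandomCluster.sum_ite_rcCondProb_ae_eq_condExp_indicator (hP : IsDLRRandomCluster d p q P)
    (hp : p ∈ Set.Icc (0 : ℝ) 1) (hq : 0 < q) (Λ : Finset (Site d)) {A : Set (BondConfig (Site d))}
    (hAm : MeasurableSet A) (hA : DeterminedBy A ↑(edgesIn (zdGraph d) Λ)) [DecidablePred (· ∈ A)] :
    (fun ξ : BondConfig (Site d) => ∑ η ∈ (edgesIn (zdGraph d) Λ).powerset,
        (if (↑η : BondConfig (Site d)) ∈ A then rcCondProb p q Λ ξ η else 0)) =ᵐ[P]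
      P[A.indicator (fun _ => (1 : ℝ)) | outsideEvents d Λ] := by
  have h : (fun ξ : BondConfig (Site d) => ∑ η ∈ (edgesIn (zdGraph d) Λ).powerset,
      (if (↑η : BondConfig (Site d)) ∈ A then rcCondProb p q Λ ξ η else 0)) =
      fun ξ => (rcCondLaw p q Λ ξ A).toReal :=
    funext fun ξ => (toReal_rcCondLaw_apply_eq_sum_ite hp hq Λ ξ hAm hA).symm
  rw [h]
  exact hP.toReal_rcCondLaw_ae_eq_condExp_indicator hp hq Λ hAm

/-- **The DLR equation for an `E_Λ`-event in pattern-sum form**: `P(A) = ∫ ∑_{η ∈ A} φ^ξ_{Λ,p,q}(η) P(dξ)` for a measurable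
`A` determined by `E_Λ`. [cite: Grimmett2006, Def. (4.29) eq. (4.30)] -/
theorem IsDLRRandomCluster.real_eq_integral_sum_ite_rcCondProb (hP : IsDLRRandomCluster d p q P)
    (hp : p ∈ Set.Icc (0 : ℝ) 1) (hq : 0 < q) (Λ : Finset (Site d)) {A : Set (BondConfig (Site d))}
    (hAm : MeasurableSet A) (hA : DeterminedBy A ↑(edgesIn (zdGraph d) Λ)) [DecidablePred (· ∈ A)] :
    P.real A = ∫ ξ, ∑ η ∈ (edgesIn (zdGraph d) Λ).powerset,
      (if (↑η : BondConfig (Site d)) ∈ A then rcCondProb p q Λ ξ η else 0) ∂P := by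
  haveI := hP.isProbabilityMeasure
  have hmeasE : Measurable fun ξ : BondConfig (Site d) => rcCondLaw p q Λ ξ A :=
    (measurable_rcCondLaw_apply_outsideEvents p q Λ hAm).mono (outsideEvents_le Λ) le_rfl
  calc P.real A = (∫⁻ ξ, rcCondLaw p q Λ ξ A ∂P).toReal := by rw [hP.lintegral_rcCondLaw_eq Λ hAm, measureReal_def]
    _ = ∫ ξ, (rcCondLaw p q Λ ξ A).toReal ∂P :=
        (integral_toReal hmeasE.aemeasurable
          (ae_of_all _ fun ξ => (rcCondLaw_apply_le_one hp hq Λ ξ hAm).trans_lt ENNReal.one_lt_top)).symm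
    _ = _ := integral_congr_ae (ae_of_all _ fun ξ => toReal_rcCondLaw_apply_eq_sum_ite hp hq Λ ξ hAm hA)

end Kernel

/-! ### Prop. (4.37)(c): tail-trivial DLR random-cluster measures are positively associated -/

section PositiveAssociation

variable {P : Measure (BondConfig (Site d))}

/-- **Grimmett 2006, Prop. (4.37)(c) — positive association of tail-trivial DLR random-cluster measures**: let
`0 ≤ p ≤ 1`, `q ≥ 1`, and let `P ∈ R_{p,q}` (`IsDLRRandomCluster d p q P`) be carried by lattice configurations and
tail-trivial.  Then for increasing events `A`, `B` determined by the edges `E_Δ` of a finite region `Δ`,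
`P(A) · P(B) ≤ P(A ∩ B)`.  Proof as printed: by the DLR equation and the positive association of the kernel
`φ^ξ_{Λ_n,p,q}` (`sum_ite_rcCondProb_mul_sum_le`), `P(A ∩ B) ≥ ∫ P[1_A|𝒯_{Λ_n}] P[1_B|𝒯_{Λ_n}] dP = ∫_A P[1_B|𝒯_{Λ_n}] dP`
for the regions `Λ_n = Δ ∪ Λ_n^{box}`, and `∫ |P[1_B|𝒯_{Λ_n}] - P(B)| dP → 0` along a subsequence (Lévy's
downward theorem and tail-triviality, `exists_strictMono_tendsto_integral_abs_condExp_outsideEvents_sub_of_isTailTrivial`).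
[cite: Grimmett2006, Prop. (4.37)(c)] -/
theorem IsDLRRandomCluster.real_mul_le_real_inter_of_isTailTrivial (hP : IsDLRRandomCluster d p q P)
    (hp : p ∈ Set.Icc (0 : ℝ) 1) (hq : 1 ≤ q) (hlat : ∀ᵐ ω ∂P, ω ⊆ (zdGraph d).edgeSet)
    (htail : IsTailTrivial (V := Sym2 (Site d)) (S := Prop) P) {Δ : Finset (Site d)}
    {A B : Set (BondConfig (Site d))} (hA : IsUpperSet A) (hAΔ : DeterminedBy A ↑(edgesIn (zdGraph d) Δ))
    (hB : IsUpperSet B) (hBΔ : DeterminedBy B ↑(edgesIn (zdGraph d) Δ)) :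
    P.real A * P.real B ≤ P.real (A ∩ B) := by
  classical
  haveI := hP.isProbabilityMeasure
  have hq0 : 0 < q := one_pos.trans_le hq
  have hAm : MeasurableSet A := hAΔ.measurableSet_of_finset
  have hBm : MeasurableSet B := hBΔ.measurableSet_of_finset
  -- the regions `Λ_n = Δ ∪ Λ_n^{box}`
  set Λ : ℕ → Finset (Site d) := fun n => Δ ∪ box d n with hΛ
  have hmono : Monotone Λ := fun m n hmn => Finset.union_subset_union le_rfl (box_mono d hmn)
  have hbox : ∀ n, box d n ⊆ Λ n := fun n => Finset.subset_union_right
  have hΔΛ : ∀ n, (↑(edgesIn (zdGraph d) Δ) : Set (Sym2 (Site d))) ⊆ ↑(edgesIn (zdGraph d) (Λ n)) := by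
    intro n e he
    rw [Finset.mem_coe, mem_edgesIn_iff] at he ⊢
    exact ⟨he.1, fun z hz => Finset.subset_union_left (he.2 z hz)⟩
  -- the kernel probabilities of `A`, `B`, `A ∩ B` in `Λ_n`
  set k : ℕ → Set (BondConfig (Site d)) → BondConfig (Site d) → ℝ := fun n C ξ =>
    ∑ η ∈ (edgesIn (zdGraph d) (Λ n)).powerset,
      (if (↑η : BondConfig (Site d)) ∈ C then rcCondProb p q (Λ n) ξ η else 0) with hk
  have hk01 : ∀ n C ξ, k n C ξ ∈ Set.Icc (0 : ℝ) 1 := fun n C ξ => by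
    simp only [hk]
    exact sum_ite_rcCondProb_mem_Icc hp hq0 (Λ n) ξ C
  have hk_int : ∀ n C, Integrable (k n C) P := fun n C => by
    simp only [hk]
    exact integrable_sum_ite_rcCondProb P hp hq0 (Λ n) C
  have hk_sm : ∀ n C, StronglyMeasurable[outsideEvents d (Λ n)] (k n C) := fun n C => by
    simp only [hk]
    exact (measurable_sum_ite_rcCondProb_outsideEvents p q (Λ n) C).stronglyMeasurable
  have hcond : ∀ n {C : Set (BondConfig (Site d))}, MeasurableSet C → DeterminedBy C ↑(edgesIn (zdGraph d) Δ) →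
      k n C =ᵐ[P] P[C.indicator (fun _ => (1 : ℝ)) | outsideEvents d (Λ n)] := fun n C hCm hC => by
    simp only [hk]
    exact hP.sum_ite_rcCondProb_ae_eq_condExp_indicator hp hq0 (Λ n) hCm (hC.mono (hΔΛ n))
  -- Step 1 (DLR + kernel FKG): `∫ k_n(A) k_n(B) dP ≤ P(A ∩ B)`
  have h1 : ∀ n, ∫ ξ, k n A ξ * k n B ξ ∂P ≤ P.real (A ∩ B) := by
    intro n
    have hDLR : P.real (A ∩ B) = ∫ ξ, k n (A ∩ B) ξ ∂P := by
      have h := hP.real_eq_integral_sum_ite_rcCondProb hp hq0 (Λ n) (hAm.inter hBm) ((hAΔ.inter hBΔ).mono (hΔΛ n))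
      simp only [hk]
      convert h
    rw [hDLR]
    have hprod : Integrable (fun ξ => k n A ξ * k n B ξ) P :=
      (hk_int n A).mul_bdd (c := 1) ((hk_sm n B).mono (outsideEvents_le _)).aestronglyMeasurable
        (ae_of_all _ fun ξ => by
          rw [Real.norm_eq_abs, abs_of_nonneg (hk01 n B ξ).1]
          exact (hk01 n B ξ).2)
    refine integral_mono hprod (hk_int n (A ∩ B)) fun ξ => ?_
    show k n A ξ * k n B ξ ≤ k n (A ∩ B) ξ
    simp only [hk]
    refine (sum_ite_rcCondProb_mul_sum_le hp hq (Λ n) ξ hA hB).trans_eq (Finset.sum_congr rfl fun η _ => ?_)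
    split_ifs <;> rfl
  -- Step 2 (pull-out): `∫ k_n(A) k_n(B) dP = ∫ 1_A k_n(B) dP`
  have h2 : ∀ n, ∫ ξ, k n A ξ * k n B ξ ∂P = ∫ ξ, A.indicator (fun _ => (1 : ℝ)) ξ * k n B ξ ∂P := by
    intro n
    have hprod : Integrable (fun ξ => A.indicator (fun _ => (1 : ℝ)) ξ * k n B ξ) P :=
      ((integrable_const (1 : ℝ)).indicator hAm).mul_bdd (c := 1)
        ((hk_sm n B).mono (outsideEvents_le _)).aestronglyMeasurable
        (ae_of_all _ fun ξ => by
          rw [Real.norm_eq_abs, abs_of_nonneg (hk01 n B ξ).1]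
          exact (hk01 n B ξ).2)
    have hpull : P[(fun ξ => A.indicator (fun _ => (1 : ℝ)) ξ * k n B ξ) | outsideEvents d (Λ n)] =ᵐ[P]
        fun ξ => (P[A.indicator (fun _ => (1 : ℝ)) | outsideEvents d (Λ n)]) ξ * k n B ξ :=
      condExp_mul_of_stronglyMeasurable_right (hk_sm n B) hprod ((integrable_const (1 : ℝ)).indicator hAm)
    calc ∫ ξ, k n A ξ * k n B ξ ∂P
        = ∫ ξ, (P[A.indicator (fun _ => (1 : ℝ)) | outsideEvents d (Λ n)]) ξ * k n B ξ ∂P := by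
          refine integral_congr_ae ?_
          filter_upwards [hcond n hAm hAΔ] with ξ hξ
          rw [hξ]
      _ = ∫ ξ, (P[(fun ξ => A.indicator (fun _ => (1 : ℝ)) ξ * k n B ξ) | outsideEvents d (Λ n)]) ξ ∂P :=
          (integral_congr_ae hpull).symm
      _ = ∫ ξ, A.indicator (fun _ => (1 : ℝ)) ξ * k n B ξ ∂P := integral_condExp (outsideEvents_le _)
  -- Step 3 (Lévy downward + tail triviality): `∫ |k_n(B) - P(B)| dP → 0` along a subsequence
  obtain ⟨φ, hφ, hlim⟩ := exists_strictMono_tendsto_integral_abs_condExp_outsideEvents_sub_of_isTailTrivial htail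
    hlat hmono hbox ((integrable_const (1 : ℝ)).indicator hBm) (C := 1) (f := B.indicator fun _ => (1 : ℝ))
    (fun x => by
      by_cases hx : x ∈ B
      · simp [Set.indicator_of_mem hx]
      · simp [Set.indicator_of_notMem hx])
  have hPB : ∫ y, B.indicator (fun _ => (1 : ℝ)) y ∂P = P.real B := integral_indicator_one hBm
  set e : ℕ → ℝ := fun j => ∫ ξ, |k (φ j) B ξ - P.real B| ∂P with he
  have he_eq : ∀ j, e j = ∫ x, |(P[B.indicator (fun _ => (1 : ℝ)) | outsideEvents d (Λ (φ j))]) x -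
      ∫ y, B.indicator (fun _ => (1 : ℝ)) y ∂P| ∂P := fun j => by
    rw [hPB]
    refine integral_congr_ae ?_
    filter_upwards [hcond (φ j) hBm hBΔ] with ξ hξ
    rw [hξ]
  have he_lim : Tendsto e atTop (𝓝 0) := by
    refine hlim.congr' (Eventually.of_forall fun j => (he_eq j).symm)
  -- Step 4: `P(A) P(B) - e_j ≤ ∫ 1_A k_{φ j}(B) dP`
  have h4 : ∀ j, P.real A * P.real B - e j ≤ ∫ ξ, A.indicator (fun _ => (1 : ℝ)) ξ * k (φ j) B ξ ∂P := by
    intro j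
    set n := φ j
    have hint1 : Integrable (fun ξ => A.indicator (fun _ => (1 : ℝ)) ξ * P.real B - |k n B ξ - P.real B|) P :=
      (((integrable_const (1 : ℝ)).indicator hAm).mul_const _).sub ((hk_int n B).sub (integrable_const _)).abs
    have hint2 : Integrable (fun ξ => A.indicator (fun _ => (1 : ℝ)) ξ * k n B ξ) P :=
      ((integrable_const (1 : ℝ)).indicator hAm).mul_bdd (c := 1)
        ((hk_sm n B).mono (outsideEvents_le _)).aestronglyMeasurable
        (ae_of_all _ fun ξ => by
          rw [Real.norm_eq_abs, abs_of_nonneg (hk01 n B ξ).1]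
          exact (hk01 n B ξ).2)
    have hle : ∫ ξ, (A.indicator (fun _ => (1 : ℝ)) ξ * P.real B - |k n B ξ - P.real B|) ∂P ≤
        ∫ ξ, A.indicator (fun _ => (1 : ℝ)) ξ * k n B ξ ∂P := by
      refine integral_mono hint1 hint2 fun ξ => ?_
      by_cases hξ : ξ ∈ A
      · simp only [Set.indicator_of_mem hξ, one_mul]
        linarith [le_abs_self (P.real B - k n B ξ), abs_sub_comm (k n B ξ) (P.real B)]
      · simp only [Set.indicator_of_notMem hξ, zero_mul, zero_sub]
        exact neg_nonpos.2 (abs_nonneg _)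
    have hint_a : Integrable (fun ξ => A.indicator (fun _ => (1 : ℝ)) ξ * P.real B) P :=
      ((integrable_const (1 : ℝ)).indicator hAm).mul_const _
    have hint_b : Integrable (fun ξ => |k n B ξ - P.real B|) P := ((hk_int n B).sub (integrable_const _)).abs
    have hPA : ∫ y, A.indicator (fun _ => (1 : ℝ)) y ∂P = P.real A := integral_indicator_one hAm
    have heq : ∫ ξ, (A.indicator (fun _ => (1 : ℝ)) ξ * P.real B - |k n B ξ - P.real B|) ∂P =
        P.real A * P.real B - e j := by
      rw [integral_sub hint_a hint_b, integral_mul_const, hPA]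
    linarith
  -- Step 5: let `j → ∞`
  have h5 : ∀ j, P.real A * P.real B - e j ≤ P.real (A ∩ B) := fun j =>
    (h4 j).trans ((h2 (φ j)).symm.le.trans (h1 (φ j)))
  have hlim' : Tendsto (fun j => P.real A * P.real B - e j) atTop (𝓝 (P.real A * P.real B)) := by
    simpa using (tendsto_const_nhds (x := P.real A * P.real B)).sub he_lim
  exact le_of_tendsto' hlim' h5

end PositiveAssociation

end Summit.CriticalPhenomena.PercolationContinuityZ3.Theorems.FK

end
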